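import Summits.NavierStokesRegularity.NavierStokesRegularity.Theorems.CircuitTrace.Negative.Structure
import Summits.NavierStokesRegularity.NavierStokesRegularity.Theorems.PerpetualPumpCircuitTraceTerminalTrace
import Summits.NavierStokesRegularity.NavierStokesRegularity.Theorems.PerpetualPumpCircuitTraceBlockStaysQuiet
import Summits.NavierStokesRegularity.NavierStokesRegularity.Theorems.PerpetualPumpCircuitTraceTraceEndgame
import Summits.NavierStokesRegularity.NavierStokesRegularity.Theorems.PerpetualPumpCircuitTraceTiltedGronwall
import Summits.NavierStokesRegularity.NavierStokesRegularity.Theorems.PerpetualPumpCircuitTraceQuietImpliesRegular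
import Summits.NavierStokesRegularity.NavierStokesRegularity.Theorems.PerpetualPumpCircuitTraceValveBudget
import HarnessLib

/-!
# `PerpetualPump.CircuitTrace` (crux stmt-NavierStokesRegularity-1836) — line `tilted-trace-gronwall`, composition

The dyadic ESS / trace theorem for Tao's viscous circuit class (Tao2016AveragedNS (4.3), α = 2/5): for every
`lam > 1` and every symmetric, cyclic-cancelling circuit, a solution on `[0,T)` with no modes below scale `0`,
a-priori `H¹⁰`-bounded on compact sub-intervals and with bounded `ℓ³`-in-scale critical norm stays `H¹⁰`-bounded
up to `T` (`CircuitTrace_of : Summit.NavierStokesRegularity.NavierStokesRegularity.Theses.PerpetualPump.CircuitTrace`).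

Units: critical amplitude `a_{i,n} = lam^{n/5}|X_{i,n}|`, clock of scale `n` = `lam^{4n/5}`.
Composition (lead prover, reshaped from the planner's skeleton `Cruxes/CircuitTrace/Lines/tilted-trace-gronwall.lean`):
`ℓ³ ⇒ sup a ≤ A := max M 1` (`circuitTrace_critSupBound_of_l3`); if the `H¹⁰` weight were unbounded, SYNCHRONY
(`circuitTrace_synchrony`, from the quiet-valve budget S1 `stub_valveBudget`, the first maximum principle S2a
`stub_blockStaysQuiet` and ε-regularity S2b `stub_quietImpliesRegular`, by a final-window dichotomy) gives
`δ`-hot fronts within `R` own-clock units of `T` at arbitrarily high scales; the tilted Grönwall lever S4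
`stub_tiltedGronwall` (tilt `β = 2/5`), the terminal traces S5 `stub_terminalTrace` (`ℓ³`-bounded) and the Toeplitz
endgame S6 `stub_traceEndgame` say such paced fronts are impossible (`circuitTrace_of_parts`). The stubs are the
landed helper files `Theorems/PerpetualPumpCircuitTrace<Stub>.lean` (same namespace `…Theorems.PerpetualPumpCircuitTrace`).
-/

noncomputable section

-- the nested summit namespace `…NavierStokesRegularity.NavierStokesRegularity…` is the tree's layout (D-0017)
set_option linter.dupNamespace false

namespace Summit.NavierStokesRegularity.NavierStokesRegularity.Theorems.PerpetualPumpCircuitTrace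

open Finset Real Set Filter Topology
open Summit.NavierStokesRegularity.NavierStokesRegularity.Theorems.CircuitTrace.Negative
  (circuitRHS IsSymm IsCyclic CircuitTrace' circuitTrace_iff)

/-! ## Proved glue -/

/-- From the crux's `ℓ³` hypothesis every critical amplitude is `≤ max M 1` (a single cube is `≤ M`). -/
theorem circuitTrace_critSupBound_of_l3 {lam : ℝ} (hlam : 1 < lam) {m : ℕ} {T M : ℝ} {X : Fin m → ℤ → ℝ → ℝ}
    (hM : ∀ t ∈ Set.Ico 0 T, ∀ s : Finset ℤ,
      ∑ n ∈ s, ∑ i : Fin m, (lam ^ ((1 / 5 : ℝ) * n) * |X i n t|) ^ 3 ≤ M) :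
    ∀ t ∈ Set.Ico 0 T, ∀ (i : Fin m) (n : ℤ), lam ^ ((1 / 5 : ℝ) * n) * |X i n t| ≤ max M 1 := by
  have hlam0 : 0 < lam := by linarith
  intro t ht i n
  have h1 := hM t ht {n}
  rw [Finset.sum_singleton] at h1
  have hpow : 0 ≤ lam ^ ((1 / 5 : ℝ) * n) := (Real.rpow_pos_of_pos hlam0 _).le
  have h0 : 0 ≤ lam ^ ((1 / 5 : ℝ) * n) * |X i n t| := mul_nonneg hpow (abs_nonneg _)
  have h2 : (lam ^ ((1 / 5 : ℝ) * n) * |X i n t|) ^ 3 ≤ M :=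
    le_trans (Finset.single_le_sum (f := fun j => (lam ^ ((1 / 5 : ℝ) * n) * |X j n t|) ^ 3)
      (fun j _ => pow_nonneg (mul_nonneg hpow (abs_nonneg _)) 3) (Finset.mem_univ i)) h1
  by_contra hlt
  have hlt' := not_le.mp hlt
  set x := lam ^ ((1 / 5 : ℝ) * n) * |X i n t| with hx
  have h3 : 1 ≤ x := (lt_of_le_of_lt (le_max_right _ _) hlt').le
  have h4 : M < x := lt_of_le_of_lt (le_max_left _ _) hlt'
  have h5 : x ≤ x ^ 3 := by
    have hx1 : 1 ≤ x * x := by nlinarith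
    calc x = x * 1 := (mul_one x).symm
      _ ≤ x * (x * x) := mul_le_mul_of_nonneg_left hx1 h0
      _ = x ^ 3 := by ring
  linarith

/-- Own-clock windows shrink: for `lam > 1`, `R ≥ 0`, `T > 0` there is a scale `g₀` beyond which
`R · lam^{-4g/5} < T` (adapted from `Lines/cold-gap-starvation.lean`, `circuitTrace_exists_window_lt`). -/
theorem circuitTrace_exists_window_lt {lam : ℝ} (hlam : 1 < lam) {R T : ℝ} (hR : 0 ≤ R) (hT : 0 < T) :
    ∃ g₀ : ℕ, ∀ g : ℕ, g₀ ≤ g → R * lam ^ (-((4 / 5 : ℝ) * g)) < T := by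
  have hlam0 : 0 < lam := by linarith
  set r : ℝ := lam ^ (-(4 / 5 : ℝ)) with hr
  have hr1 : r < 1 := Real.rpow_lt_one_of_one_lt_of_neg hlam (by norm_num)
  have hpow : ∀ g : ℕ, lam ^ (-((4 / 5 : ℝ) * g)) = r ^ g := by
    intro g
    rw [hr, ← Real.rpow_natCast, ← Real.rpow_mul hlam0.le]
    congr 1
    ring
  obtain ⟨n, hn⟩ := exists_pow_lt_of_lt_one (show 0 < T / (R + 1) by positivity) hr1
  refine ⟨n, fun g hg => ?_⟩
  have hr0 : 0 ≤ r := (Real.rpow_pos_of_pos hlam0 _).le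
  have hmono : r ^ g ≤ r ^ n := pow_le_pow_of_le_one hr0 hr1.le hg
  have hRT : R * (T / (R + 1)) < T := by
    have hR1 : (0 : ℝ) < R + 1 := by linarith
    have hlt : R / (R + 1) < 1 := by rw [div_lt_one hR1]; linarith
    calc R * (T / (R + 1)) = R / (R + 1) * T := by ring
      _ < 1 * T := mul_lt_mul_of_pos_right hlt hT
      _ = T := one_mul T
  calc R * lam ^ (-((4 / 5 : ℝ) * g)) = R * r ^ g := by rw [hpow]
    _ ≤ R * r ^ n := mul_le_mul_of_nonneg_left hmono hR
    _ ≤ R * (T / (R + 1)) := mul_le_mul_of_nonneg_left hn.le hR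
    _ < T := hRT

/-- **SYNCHRONY (planner's S3), proved from S1 + S2a + S2b.** For every cyclic circuit and amplitude bound `A` there
are `δ > 0` and `R` such that every solution of the crux's class with `sup a ≤ A` whose `H¹⁰` weight is unbounded on
`[0,T)` has, at arbitrarily high scales `g`, a `δ`-hot instant `t ∈ (0,T)` with `lam^{4g/5}(T - t) ≤ R` (paced
fronts; the proof gives one at EVERY large scale). Argument: `δ := min δ₀ (min δ₁ (ε₀/2))`, `R := 2C⁺/δ² + 2`; if the
final window `[T - R·lam^{-4g/5}, T)` of a large scale `g` carries no `δ`-hot instant of `g`, the valve `g` is quiet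
there; either the block above `g` is `δ`-quiet at some instant of the window (S2a: it stays `2δ ≤ ε₀`-quiet, S2b:
regular — contradiction) or it is active at every instant, and S1 on the first half of the window gives
`C⁺ + δ² ≤ C`. -/
theorem circuitTrace_synchrony {lam : ℝ} (hlam : 1 < lam) {m : ℕ}
    (coeff : Fin m → Fin m → Fin m → Option (Fin 3) → ℝ) (hcyc : IsCyclic coeff) (A : ℝ) :
    ∃ δ : ℝ, 0 < δ ∧ ∃ R : ℝ, ∀ (T : ℝ) (X : Fin m → ℤ → ℝ → ℝ), 0 < T →
      (∀ (i : Fin m) (n : ℤ), ∀ t ∈ Set.Ioo 0 T, HasDerivAt (X i n) (circuitRHS lam coeff X i n t) t) →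
      (∀ (i : Fin m) (n : ℤ) (t : ℝ), n < 0 → X i n t = 0) →
      (∀ T' ∈ Set.Ioo 0 T, ∃ C : ℝ, ∀ (i : Fin m) (n : ℤ), ∀ t ∈ Set.Icc 0 T',
        lam ^ ((4 : ℝ) * n) * |X i n t| ≤ C) →
      (∀ t ∈ Set.Ico 0 T, ∀ (i : Fin m) (n : ℤ), lam ^ ((1 / 5 : ℝ) * n) * |X i n t| ≤ A) →
      (¬ ∃ C : ℝ, ∀ (i : Fin m) (j : ℤ), ∀ t ∈ Set.Ico 0 T, lam ^ ((4 : ℝ) * j) * |X i j t| ≤ C) →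
      ∀ n₀ : ℕ, ∃ n : ℕ, n₀ ≤ n ∧ ∃ i : Fin m, ∃ t ∈ Set.Ioo 0 T,
        lam ^ ((4 / 5 : ℝ) * n) * (T - t) ≤ R ∧ δ ≤ lam ^ ((1 / 5 : ℝ) * n) * |X i n t| := by
  obtain ⟨δ₀, hδ₀, C, hV⟩ := stub_valveBudget lam hlam m coeff hcyc A
  obtain ⟨δ₁, hδ₁, hQ⟩ := stub_blockStaysQuiet lam hlam m coeff A
  obtain ⟨ε₀, hε₀, hReg⟩ := stub_quietImpliesRegular lam hlam m coeff A
  have hlam0 : 0 < lam := by linarith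
  set δ : ℝ := min δ₀ (min δ₁ (ε₀ / 2)) with hδdef
  have hδ : 0 < δ := lt_min hδ₀ (lt_min hδ₁ (by linarith))
  have hδ₀' : δ ≤ δ₀ := min_le_left _ _
  have hδ₁' : δ ≤ δ₁ := (min_le_right _ _).trans (min_le_left _ _)
  have hδε : 2 * δ ≤ ε₀ := by
    have : δ ≤ ε₀ / 2 := (min_le_right _ _).trans (min_le_right _ _)
    linarith
  set R : ℝ := 2 * max C 0 / δ ^ 2 + 2 with hRdef
  have hR0 : 0 ≤ R := by
    have : 0 ≤ 2 * max C 0 / δ ^ 2 := by positivity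
    rw [hRdef]; linarith
  refine ⟨δ, hδ, R, fun T X hT hderiv hcut hapr hA hnreg n₀ => ?_⟩
  obtain ⟨g₀, hwin⟩ := circuitTrace_exists_window_lt hlam hR0 hT
  set g : ℕ := max n₀ g₀ with hgdef
  refine ⟨g, le_max_left _ _, ?_⟩
  by_contra hno
  push Not at hno
  -- hno : ∀ i, ∀ t ∈ Ioo 0 T, lam^{4g/5}(T - t) ≤ R → a_{i,g}(t) < δ
  set w : ℝ := R * lam ^ (-((4 / 5 : ℝ) * g)) with hwdef
  have hwT : w < T := hwin g (le_max_right _ _)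
  have hpow0 : 0 < lam ^ ((4 / 5 : ℝ) * g) := Real.rpow_pos_of_pos hlam0 _
  have hcancel : lam ^ ((4 / 5 : ℝ) * g) * lam ^ (-((4 / 5 : ℝ) * g)) = 1 := by
    rw [Real.rpow_neg hlam0.le, mul_inv_cancel₀ hpow0.ne']
  have hw0 : 0 < w := by
    have hR2 : 2 ≤ R := by
      have : 0 ≤ 2 * max C 0 / δ ^ 2 := by positivity
      rw [hRdef]; linarith
    rw [hwdef]
    exact mul_pos (by linarith) (Real.rpow_pos_of_pos hlam0 _)
  set t₁ : ℝ := T - w with ht₁def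
  have ht₁0 : 0 < t₁ := by rw [ht₁def]; linarith
  have ht₁T : t₁ < T := by rw [ht₁def]; linarith
  -- the valve g is δ-quiet on [t₁, T)
  have hvalve : ∀ i : Fin m, ∀ t ∈ Set.Ico t₁ T, lam ^ ((1 / 5 : ℝ) * (g : ℤ)) * |X i g t| < δ := by
    intro i t ht
    have h := hno i t ⟨lt_of_lt_of_le ht₁0 ht.1, ht.2⟩ (by
      have h1 : T - t ≤ w := by have := ht.1; rw [ht₁def] at this; linarith
      calc lam ^ ((4 / 5 : ℝ) * g) * (T - t) ≤ lam ^ ((4 / 5 : ℝ) * g) * w :=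
            mul_le_mul_of_nonneg_left h1 hpow0.le
        _ = R := by rw [hwdef, mul_left_comm, hcancel, mul_one])
    exact_mod_cast h
  have hg0 : (0 : ℤ) ≤ (g : ℤ) := Int.natCast_nonneg g
  by_cases hcase : ∃ t' ∈ Set.Ico t₁ T, ∀ (i : Fin m) (j : ℤ), (g : ℤ) < j →
      lam ^ ((1 / 5 : ℝ) * j) * |X i j t'| ≤ δ
  · -- Case A: the block above g is δ-quiet at some instant t' of the window ⇒ regular
    obtain ⟨t', ht', hblock⟩ := hcase
    have ht'0 : 0 < t' := lt_of_lt_of_le ht₁0 ht'.1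
    have hval' : ∀ i : Fin m, ∀ t ∈ Set.Ico t' T, lam ^ ((1 / 5 : ℝ) * (g : ℤ)) * |X i g t| ≤ δ :=
      fun i t ht => (hvalve i t ⟨le_trans ht'.1 ht.1, ht.2⟩).le
    have h2δ := hQ δ hδ hδ₁' T X hT hderiv hcut hapr hA g hg0 t' ⟨ht'0, ht'.2⟩ hval' hblock
    refine hnreg (hReg T X hT hderiv hcut hapr hA g hg0 t' ⟨ht'0, ht'.2⟩ ?_)
    intro i j hj t ht
    rcases eq_or_lt_of_le hj with hjg | hjg
    · rw [← hjg]
      have := hval' i t ht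
      linarith
    · exact (h2δ i j hjg t ht).trans hδε
  · -- Case B: at every instant of the window some mode above g is δ-active ⇒ valve budget on [t₁, T - w/2]
    push Not at hcase
    set t₂ : ℝ := T - w / 2 with ht₂def
    have ht₁₂ : t₁ ≤ t₂ := by rw [ht₁def, ht₂def]; linarith
    have ht₂T : t₂ < T := by rw [ht₂def]; linarith
    have hbud := hV δ hδ hδ₀' T X hT hderiv hcut hapr hA g hg0 t₁ t₂ ht₁0 ht₁₂ ht₂T
      (fun i t ht => (hvalve i t ⟨ht.1, lt_of_le_of_lt ht.2 ht₂T⟩).le)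
      (fun t ht => by
        obtain ⟨i, j, hj, hlt⟩ := hcase t ⟨ht.1, lt_of_le_of_lt ht.2 ht₂T⟩
        exact ⟨i, j, hj, hlt.le⟩)
    -- window algebra: δ² lam^{4(g+1)/5} (t₂ - t₁) = δ² lam^{4/5} R / 2 ≥ max C 0 + δ²
    have hlen : t₂ - t₁ = R / 2 * lam ^ (-((4 / 5 : ℝ) * g)) := by
      rw [ht₂def, ht₁def, hwdef]; ring
    have hsplit : lam ^ ((4 / 5 : ℝ) * (((g : ℤ) : ℝ) + 1))
        = lam ^ ((4 / 5 : ℝ) * g) * lam ^ (4 / 5 : ℝ) := by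
      rw [← Real.rpow_add hlam0]
      push_cast
      ring_nf
    have hval : δ ^ 2 * lam ^ ((4 / 5 : ℝ) * (((g : ℤ) : ℝ) + 1)) * (t₂ - t₁)
        = δ ^ 2 * lam ^ (4 / 5 : ℝ) * (R / 2) := by
      rw [hlen, hsplit]
      calc δ ^ 2 * (lam ^ ((4 / 5 : ℝ) * g) * lam ^ (4 / 5 : ℝ)) * (R / 2 * lam ^ (-((4 / 5 : ℝ) * g)))
          = δ ^ 2 * lam ^ (4 / 5 : ℝ) * (R / 2)
              * (lam ^ ((4 / 5 : ℝ) * g) * lam ^ (-((4 / 5 : ℝ) * g))) := by ring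
        _ = δ ^ 2 * lam ^ (4 / 5 : ℝ) * (R / 2) := by rw [hcancel, mul_one]
    rw [hval] at hbud
    have h45 : 1 ≤ lam ^ (4 / 5 : ℝ) := Real.one_le_rpow hlam.le (by norm_num)
    have hδ2 : 0 < δ ^ 2 := by positivity
    have hR2 : δ ^ 2 * (R / 2) = max C 0 + δ ^ 2 := by
      rw [hRdef]
      field_simp
    have hlow : δ ^ 2 * (R / 2) ≤ δ ^ 2 * lam ^ (4 / 5 : ℝ) * (R / 2) := by
      have hR2' : 0 ≤ R / 2 := by linarith
      calc δ ^ 2 * (R / 2) = δ ^ 2 * 1 * (R / 2) := by ring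
        _ ≤ δ ^ 2 * lam ^ (4 / 5 : ℝ) * (R / 2) := by gcongr
    have hC : C ≤ max C 0 := le_max_left _ _
    linarith

/-- **Composition: the crux in its restated form `CircuitTrace'`.** Fix the crux data
with `ℓ³` bound `M` and suppose the `H¹⁰` weight is unbounded on `[0,T)`; `A := max M 1` bounds every critical
amplitude (`circuitTrace_critSupBound_of_l3`); `circuitTrace_synchrony` gives paced fronts `(δ, R)`; S4 with tilt `β = 2/5 > 1/5` gives `Γ`
and the tilted Grönwall inequality; S5 the terminal trace with its `ℓ³` bound; S6 says paced fronts are then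
impossible. -/
theorem circuitTrace_of_parts : CircuitTrace' := by
  intro lam hlam m coeff _hsym hcyc T hT X _hcont hderiv hcut hapr hM3
  obtain ⟨M, hM⟩ := hM3
  by_contra hreg
  have hA := circuitTrace_critSupBound_of_l3 hlam hM
  obtain ⟨δ, hδ, R, hsync⟩ := circuitTrace_synchrony hlam coeff hcyc (max M 1)
  have hfr := hsync T X hT hderiv hcut hapr hA hreg
  obtain ⟨Γ, _hΓ, hgr⟩ := stub_tiltedGronwall lam hlam (2 / 5) m coeff (max M 1)
  obtain ⟨τ, hτ, hτM⟩ := stub_terminalTrace lam hlam m coeff T M X hT hderiv hcut hM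
  exact stub_traceEndgame lam hlam (2 / 5) (by norm_num) m Γ δ R M T X τ hδ (hgr T X hderiv hcut hA) hτ hτM hfr

/-- **The crux BY NAME**: the six landed stubs, fed through `circuitTrace_synchrony` and
`circuitTrace_of_parts` and transported along the landed `circuitTrace_iff` (`Iff.rfl`), give
`Summit.NavierStokesRegularity.NavierStokesRegularity.Theses.PerpetualPump.CircuitTrace`. -/
theorem CircuitTrace_of :
    _root_.Summit.NavierStokesRegularity.NavierStokesRegularity.Theses.PerpetualPump.CircuitTrace :=
  circuitTrace_iff.mpr circuitTrace_of_parts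

end Summit.NavierStokesRegularity.NavierStokesRegularity.Theorems.PerpetualPumpCircuitTrace

end
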